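import Summits.QuantumFields.BalabanUV.Beta.CombHId2W2SymSwap
import Summits.QuantumFields.BalabanUV.Beta.NVertexParitiesW

/-!
# `BalabanUV.Beta.NVertexWoundPeriodised` — row D1 ∕ (C1), PART 16: **THE WOUND SECOND-ORDER N-FAMILY, PERIODISED, IS an1's SWAP-SYMMETRISED CARRIER THROUGH
# THE N-CHART OVER THE PERIODISED COMPOSITE TABLES** — `dper M (x z ↦ Σ'_n WN R P j μ y ν (y′ + M′∘n) x z) = W2SymOfK (AN R j) (Lc^(j+1)) S^per Mt^per T2^{per,csf}
# M2^{per,cs} μ y ν y′` (`M = Lc^(j+1)·M′`), the N-system twin of `CombHId2W2Record.dper_tsum_WcombOf` — so EVERY order-2 fold ∕ torus reading the row typed for the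
# comb chart at (C2) (`CombHId2Folds`, `CombHId2FoldsSlots`, `CombHId2Torus`, `CombHId2TorusWords`; chart `K` GENERIC there) applies to the wound N rows of (R1)
# verbatim at `K := AN R j`

WHY.  (R1) «wound rows» (road FP g42 A-1 l.67696, SPEC-54 §9; law v-next `TowerKernelLawNamedC`, END wrapper v5): the second-order torus rows of the tower read
`perF T (dper T (x z ↦ Σ'_e WN♮ μ y ν (y′ + Mc∘e) x z))`, `T = Lc^(n+2)·Mc` (road (H) `towerTorus_fine_apply`).  The row's (C2) series typed, for a GENERIC
fine-period-invariant decaying chart `K` and an1's carrier `W2SymOfK K N S Mt S₂ M₂` over block-covariant localised tables, exactly this copy-summed periodisation: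
`CombHId2W2SymSwap.dper_tsum_W2SymOfK_translate` (the copy sum moves INTO the two second-order slots — `S₂^{per,csf}`: second FINE bond copy-summed then `dper`;
`M₂^{per,cs}`: second COARSE bond copy-summed then `dper` — and `dper` onto the two first-order slots), followed by the folds and torus readings of the four words
(`vertex2OfK ∕ mixOfK ∕ mixOfK-swapped ∕ dM (K2OfK …)`).  PART 13 `NVertexParitiesW.WN_eq_W2SymOfK` says `WN R P j` IS that carrier at `K := AN R j = compChart …`,
`N := Lc^(j+1)`, tables := the composite record `tabsComp (j+1) …` at recursion index `0`; F6d-1b `decays_compChart` ∕ `shiftK_compChart` and the record's eight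
`SymTables` letters (through `RecursiveStencilSlot.locStencil_SpureRecOf ∕ SpureRecOf_translate`, `RecursiveWSlot.T2RecOf_loc ∕ T2RecOf_translate`, lit
`BalabanStepW2.locStencilFM_M2Of ∕ M2Of_translate`) discharge every socket BY NAME.  Nothing new is estimated.

WHAT ([folklore] bookkeeping BY NAME; no `def`, no `def … : Prop`, nothing cited, 0 sorry): §1 the N-record's letters for the sockets — `decays_AN_family`,
`shiftK_AN`, `exists_locStencil_SN`, `SN_translate`, `exists_locStencil₂_T2N`, `T2N_translate`, `exists_locStencilFM_M2N`; §2 **`dper_tsum_WN`** and its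
bond-family form **`WN_wound_per_eq`**.
WHAT THIS IS NOT: not the torus readings `perF T (…)` of the four words at `K := AN R j` (they are `CombHId2Folds.perF_vertex2OfK_of_periodic₂′ ∕ perF_mixOfK_of_periodic₂′`
and `CombHId2TorusWords` at this letter — the row's PART 17, on road (H)'s seam); not the even half `WN♮` (linearity + road (D) `WoundEvenFamilyParities`' `dper_trK ∕
dper_sgnK`); not the (C1) table word at order 2 (the match of these four words against `compVH2Ker ℓˢ 𝓋ˢ 𝓋₂ˢ`'s summands); no row of the END wrapper discharged; nothing of
Bałaban's asserted, valued or discharged; 0 estimates; 0∕4 row-D1 binders (hW, hR, D1Tel, D1Rep); ROOT M‴ p325680 ∕ P5c ∕ D6 untouched; NOT (C1), NOT (T-ID), NOT D1,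
NEVER «G-an2-4 closed», NOT BetaPertH, NOT continuum, NOT Clay.

HONEST DEPENDENCY (page 1, mandatory): continuum YM on T⁴ ⇐ BetaPertH ∧ nine spine estimates (0/9 proved); BetaPertH ⇐ (D1) ∧ (D4) ∧ CAP+tail;
G-an2-4 gates asym, D1 and NE2/3/4.  HONEST FRAMING (cell contract, verbatim): «discharging `BetaPertH` makes Bałaban's UV stability UNCONDITIONAL —
a real constructive-QFT result; it is NOT the continuum limit and NOT the Clay problem.»  ABSOLUTE RULE (cell charter, verbatim): «No internally-minted
statement may enter as a cited fact. Every hypothesis is either kernel-proved in this package or a verbatim quotation of a PUBLISHED theorem with page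
reference. The manuscript(s) under audit are NOT citable for their own disputed steps — they are the thing under adjudication; programme-internal
(2001/route/tribunal) claims are never citable.»  Row D1 ∕ (C1) OWNER an2 (b2b-balaban-beta-an2) gen 68, 2026-08-27.  No existing file touched.
-/

noncomputable section

open scoped BigOperators

namespace Summit.QuantumFields.BalabanUV.Beta.NVertexWoundPeriodised

open Literature.MathematicalPhysics.QuantumFieldTheory
open Literature.MathematicalPhysics.QuantumFieldTheory.Balaban1983to89
open Literature.MathematicalPhysics.QuantumFieldTheory.Balaban1983to89.Beta
open B4TorusKernel.MultiPeriod (translate)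
open ExpKernelCalculus (MKer Decays BiLoc VertexFamily shiftK)
open AffineAveraging (Site box)
open OneStepResolventKernel (Fib LocStencil)
open BalabanCompositeJets (LocStencil₂)
open BalabanStepW2 (M2Of M2Of_translate locStencilFM_M2Of)
open SecondOrderResponse (W2SymOfK LocStencilFM)
open Summit.QuantumFields.BalabanUV.Beta.AxialDressingRooted (one_le_of_neZero)
open Summit.QuantumFields.BalabanUV.Beta.SpineRooted (SpureRecOf T2RecOf locStencil_SpureRecOf SpureRecOf_translate T2RecOf_loc T2RecOf_translate)
open Summit.QuantumFields.BalabanUV.Beta.CompositeCorrectorDress (compChart)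
open Summit.QuantumFields.BalabanUV.Beta.CompositeOneShotJets (tabsComp decays_compChart shiftK_compChart)
open Summit.QuantumFields.BalabanUV.Beta.CompositeOneShotJetData (Roots Pins AN AN_eq WN)
open Summit.QuantumFields.BalabanUV.Beta.FP.KernelPeriodisationFibLoc (dper)
open Summit.QuantumFields.BalabanUV.Beta.CombHId2W2SymSwap (dper_tsum_W2SymOfK_translate)
open Summit.QuantumFields.BalabanUV.Beta.NVertexParitiesW (WN_eq_W2SymOfK)

variable {Lc : ℕ} [NeZero Lc] (R : Roots Lc) (P : Pins) (j : ℕ)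

/-! ## §1 The N-record's letters for the sockets of `dper_tsum_W2SymOfK_translate` -/

section Letters

/-- [folklore] (DG) the constant N-chart family decays (F6d-1b `decays_compChart` at the record's roots). -/
theorem decays_AN_family : ∀ _m : ℕ, ∃ δ C : ℝ, 0 < δ ∧ 0 ≤ C ∧ Decays (compChart R.rc Lc (j + 1) (R.s (j + 1)) (Lc ^ (j + 1))) C δ :=
  fun _ => decays_compChart (one_le_of_neZero Lc) R.hrc (j + 1) (R.hs (j + 1))

/-- [folklore] (TG) the N-chart is `Lc^(j+1)`-block invariant (F6d-1b `shiftK_compChart`), as a constant family. -/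
theorem shiftK_AN : ∀ (_m : ℕ) (t : Fin (3 + 1) → ℤ),
    shiftK (-(((Lc ^ (j + 1) : ℕ) : ℤ) • t)) (compChart R.rc Lc (j + 1) (R.s (j + 1)) (Lc ^ (j + 1))) = compChart R.rc Lc (j + 1) (R.s (j + 1)) (Lc ^ (j + 1)) :=
  fun _ t => shiftK_compChart (one_le_of_neZero Lc) (j + 1) t

/-- [folklore] (LS♭) every member of the N-record's pure first-order family `SpureRecOf 3 (Lc^(j+1)) V_N H_N (fun _ => AN R j) cE cVH cΛ` is a local stencil family
(`RecursiveStencilSlot.locStencil_SpureRecOf` fed the record's (LV)(LH) and (DG)). -/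
theorem exists_locStencil_SN : ∀ m : ℕ, ∃ Cs δ : ℝ, 0 < δ ∧
    LocStencil (SpureRecOf 3 (Lc ^ (j + 1)) (tabsComp (j + 1) (one_le_of_neZero Lc) R.hr (P.cM (j + 1))).V
      (tabsComp (j + 1) (one_le_of_neZero Lc) R.hr (P.cM (j + 1))).H (fun _ => compChart R.rc Lc (j + 1) (R.s (j + 1)) (Lc ^ (j + 1)))
      (P.cE (j + 1)) (P.cVH (j + 1)) (P.cΛ (j + 1)) m) Cs δ :=
  locStencil_SpureRecOf (one_le_of_neZero (Lc ^ (j + 1))) (tabsComp (j + 1) (one_le_of_neZero Lc) R.hr (P.cM (j + 1))).hV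
    (tabsComp (j + 1) (one_le_of_neZero Lc) R.hr (P.cM (j + 1))).hH (decays_AN_family R j) (P.cE (j + 1)) (P.cVH (j + 1)) (P.cΛ (j + 1))

/-- [folklore] (St) block-translation covariance of every member of the N-record's pure first-order family (`RecursiveStencilSlot.SpureRecOf_translate` fed (TV)(TH)(TG)). -/
theorem SN_translate : ∀ (m : ℕ) (κ' : Fin (3 + 1)) (u t : Fin (3 + 1) → ℤ),
    SpureRecOf 3 (Lc ^ (j + 1)) (tabsComp (j + 1) (one_le_of_neZero Lc) R.hr (P.cM (j + 1))).V
        (tabsComp (j + 1) (one_le_of_neZero Lc) R.hr (P.cM (j + 1))).H (fun _ => compChart R.rc Lc (j + 1) (R.s (j + 1)) (Lc ^ (j + 1)))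
        (P.cE (j + 1)) (P.cVH (j + 1)) (P.cΛ (j + 1)) m κ' (u + ((Lc ^ (j + 1) : ℕ) : ℤ) • t)
      = shiftK (-(((Lc ^ (j + 1) : ℕ) : ℤ) • t)) (SpureRecOf 3 (Lc ^ (j + 1)) (tabsComp (j + 1) (one_le_of_neZero Lc) R.hr (P.cM (j + 1))).V
        (tabsComp (j + 1) (one_le_of_neZero Lc) R.hr (P.cM (j + 1))).H (fun _ => compChart R.rc Lc (j + 1) (R.s (j + 1)) (Lc ^ (j + 1)))
        (P.cE (j + 1)) (P.cVH (j + 1)) (P.cΛ (j + 1)) m κ' u) :=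
  SpureRecOf_translate (tabsComp (j + 1) (one_le_of_neZero Lc) R.hr (P.cM (j + 1))).hVt (tabsComp (j + 1) (one_le_of_neZero Lc) R.hr (P.cM (j + 1))).hHt
    (shiftK_AN R j) (P.cE (j + 1)) (P.cVH (j + 1)) (P.cΛ (j + 1))

/-- [folklore] (L2) every member of the N-record's second-order field table `T2RecOf … m` is a `LocStencil₂` family (`RecursiveWSlot.T2RecOf_loc` fed (DG)(LS♭)(LM)(LB)(Lmix)). -/
theorem exists_locStencil₂_T2N : ∀ m : ℕ, ∃ C δ : ℝ, 0 < δ ∧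
    LocStencil₂ (T2RecOf 3 (Lc ^ (j + 1)) (fun _ => compChart R.rc Lc (j + 1) (R.s (j + 1)) (Lc ^ (j + 1)))
      (SpureRecOf 3 (Lc ^ (j + 1)) (tabsComp (j + 1) (one_le_of_neZero Lc) R.hr (P.cM (j + 1))).V
        (tabsComp (j + 1) (one_le_of_neZero Lc) R.hr (P.cM (j + 1))).H (fun _ => compChart R.rc Lc (j + 1) (R.s (j + 1)) (Lc ^ (j + 1)))
        (P.cE (j + 1)) (P.cVH (j + 1)) (P.cΛ (j + 1)))
      (tabsComp (j + 1) (one_le_of_neZero Lc) R.hr (P.cM (j + 1))).M (P.cE₂ (j + 1)) (P.cB (j + 1)) (P.T (j + 1))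
      (tabsComp (j + 1) (one_le_of_neZero Lc) R.hr (P.cM (j + 1))).vh₂S (tabsComp (j + 1) (one_le_of_neZero Lc) R.hr (P.cM (j + 1))).mixFF m) C δ :=
  T2RecOf_loc (P.cE₂ (j + 1)) (P.cB (j + 1)) (P.T (j + 1)) (tabsComp (j + 1) (one_le_of_neZero Lc) R.hr (P.cM (j + 1))).vh₂S
    (tabsComp (j + 1) (one_le_of_neZero Lc) R.hr (P.cM (j + 1))).mixFF (one_le_of_neZero (Lc ^ (j + 1))) (decays_AN_family R j)
    (exists_locStencil_SN R P j) (tabsComp (j + 1) (one_le_of_neZero Lc) R.hr (P.cM (j + 1))).hM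
    (tabsComp (j + 1) (one_le_of_neZero Lc) R.hr (P.cM (j + 1))).hB (tabsComp (j + 1) (one_le_of_neZero Lc) R.hr (P.cM (j + 1))).hmix

/-- [folklore] (T2t) the JOINT block covariance of every `T2RecOf … m` of the N record (`RecursiveWSlot.T2RecOf_translate` fed (TG)(St)(TM)(TB)(Tmix)). -/
theorem T2N_translate : ∀ (m : ℕ) (κ : Fin (3 + 1)) (u : Fin (3 + 1) → ℤ) (κ' : Fin (3 + 1)) (u' t : Fin (3 + 1) → ℤ),
    T2RecOf 3 (Lc ^ (j + 1)) (fun _ => compChart R.rc Lc (j + 1) (R.s (j + 1)) (Lc ^ (j + 1)))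
        (SpureRecOf 3 (Lc ^ (j + 1)) (tabsComp (j + 1) (one_le_of_neZero Lc) R.hr (P.cM (j + 1))).V
          (tabsComp (j + 1) (one_le_of_neZero Lc) R.hr (P.cM (j + 1))).H (fun _ => compChart R.rc Lc (j + 1) (R.s (j + 1)) (Lc ^ (j + 1)))
          (P.cE (j + 1)) (P.cVH (j + 1)) (P.cΛ (j + 1)))
        (tabsComp (j + 1) (one_le_of_neZero Lc) R.hr (P.cM (j + 1))).M (P.cE₂ (j + 1)) (P.cB (j + 1)) (P.T (j + 1))
        (tabsComp (j + 1) (one_le_of_neZero Lc) R.hr (P.cM (j + 1))).vh₂S (tabsComp (j + 1) (one_le_of_neZero Lc) R.hr (P.cM (j + 1))).mixFF m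
        κ (u + ((Lc ^ (j + 1) : ℕ) : ℤ) • t) κ' (u' + ((Lc ^ (j + 1) : ℕ) : ℤ) • t)
      = shiftK (-(((Lc ^ (j + 1) : ℕ) : ℤ) • t)) (T2RecOf 3 (Lc ^ (j + 1)) (fun _ => compChart R.rc Lc (j + 1) (R.s (j + 1)) (Lc ^ (j + 1)))
        (SpureRecOf 3 (Lc ^ (j + 1)) (tabsComp (j + 1) (one_le_of_neZero Lc) R.hr (P.cM (j + 1))).V
          (tabsComp (j + 1) (one_le_of_neZero Lc) R.hr (P.cM (j + 1))).H (fun _ => compChart R.rc Lc (j + 1) (R.s (j + 1)) (Lc ^ (j + 1)))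
          (P.cE (j + 1)) (P.cVH (j + 1)) (P.cΛ (j + 1)))
        (tabsComp (j + 1) (one_le_of_neZero Lc) R.hr (P.cM (j + 1))).M (P.cE₂ (j + 1)) (P.cB (j + 1)) (P.T (j + 1))
        (tabsComp (j + 1) (one_le_of_neZero Lc) R.hr (P.cM (j + 1))).vh₂S (tabsComp (j + 1) (one_le_of_neZero Lc) R.hr (P.cM (j + 1))).mixFF m κ u κ' u') :=
  T2RecOf_translate (P.cE₂ (j + 1)) (P.cB (j + 1)) (P.T (j + 1)) (shiftK_AN R j) (SN_translate R P j)
    (tabsComp (j + 1) (one_le_of_neZero Lc) R.hr (P.cM (j + 1))).hMt (tabsComp (j + 1) (one_le_of_neZero Lc) R.hr (P.cM (j + 1))).hBt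
    (tabsComp (j + 1) (one_le_of_neZero Lc) R.hr (P.cM (j + 1))).hmixt

omit [NeZero Lc] in
/-- [folklore] (Lmix₂) the weighted mixed table `M2Of 3 (Lc^(j+1)) mixFF_N m` is a `LocStencilFM` family (lit `locStencilFM_M2Of` on (Lmix)). -/
theorem exists_locStencilFM_M2N (hLc : 1 ≤ Lc) (m : ℕ) : ∃ C δ : ℝ, 0 < δ ∧
    LocStencilFM (Lc ^ (j + 1)) (M2Of 3 (Lc ^ (j + 1)) (tabsComp (j + 1) hLc R.hr (P.cM (j + 1))).mixFF m) C δ := by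
  obtain ⟨C, δ, hδ, h⟩ := (tabsComp (j + 1) hLc R.hr (P.cM (j + 1))).hmix
  exact ⟨_, δ, hδ, locStencilFM_M2Of h m⟩

end Letters

/-! ## §2 The wound second-order N-family, periodised -/

section WSlot

variable (M : Fin (3 + 1) → ℕ) [∀ μ, NeZero (M μ)] {M' : Fin (3 + 1) → ℕ}

/-- [folklore] **`dper_tsum_WN` — THE WOUND SECOND-ORDER N-FAMILY, COPY-SUMMED IN THE SECOND BOND AND PERIODISED, IS `W2SymOfK (AN R j)` OVER THE PERIODISED
COMPOSITE TABLES** (`M = Lc^(j+1)·M′`):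
`dper M (x z a c ↦ Σ'_n WN R P j μ y ν (translate M′ y′ n) x z a c) = W2SymOfK (AN R j) (Lc^(j+1)) S^per Mt^per T2^{per,csf} M2^{per,cs} μ y ν y′`
— `CombHId2W2SymSwap.dper_tsum_W2SymOfK_translate` with every socket discharged by §1 (the N twin of `CombHId2W2Record.dper_tsum_WcombOf`). -/
theorem dper_tsum_WN (hM : ∀ i, M i = Lc ^ (j + 1) * M' i) (μ : Fin (3 + 1)) (y : Site (3 + 1)) (ν : Fin (3 + 1)) (y' : Site (3 + 1)) :
    dper M (fun x z a c => ∑' n : Site (3 + 1), WN R P j μ y ν (translate M' y' n) x z a c)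
      = W2SymOfK (AN R j) (Lc ^ (j + 1))
          (fun κ u => dper M (SpureRecOf 3 (Lc ^ (j + 1)) (tabsComp (j + 1) (one_le_of_neZero Lc) R.hr (P.cM (j + 1))).V
            (tabsComp (j + 1) (one_le_of_neZero Lc) R.hr (P.cM (j + 1))).H (fun _ => compChart R.rc Lc (j + 1) (R.s (j + 1)) (Lc ^ (j + 1)))
            (P.cE (j + 1)) (P.cVH (j + 1)) (P.cΛ (j + 1)) 0 κ u))
          (fun ρ w => dper M ((tabsComp (j + 1) (one_le_of_neZero Lc) R.hr (P.cM (j + 1))).M 0 ρ w))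
          (fun κ u κ' u' => dper M (fun x z a c => ∑' n : Site (3 + 1),
            T2RecOf 3 (Lc ^ (j + 1)) (fun _ => compChart R.rc Lc (j + 1) (R.s (j + 1)) (Lc ^ (j + 1)))
              (SpureRecOf 3 (Lc ^ (j + 1)) (tabsComp (j + 1) (one_le_of_neZero Lc) R.hr (P.cM (j + 1))).V
                (tabsComp (j + 1) (one_le_of_neZero Lc) R.hr (P.cM (j + 1))).H (fun _ => compChart R.rc Lc (j + 1) (R.s (j + 1)) (Lc ^ (j + 1)))
                (P.cE (j + 1)) (P.cVH (j + 1)) (P.cΛ (j + 1)))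
              (tabsComp (j + 1) (one_le_of_neZero Lc) R.hr (P.cM (j + 1))).M (P.cE₂ (j + 1)) (P.cB (j + 1)) (P.T (j + 1))
              (tabsComp (j + 1) (one_le_of_neZero Lc) R.hr (P.cM (j + 1))).vh₂S (tabsComp (j + 1) (one_le_of_neZero Lc) R.hr (P.cM (j + 1))).mixFF 0
              κ u κ' (translate M u' n) x z a c))
          (fun κ u ρ w => dper M (fun x z a c => ∑' n : Site (3 + 1),
            M2Of 3 (Lc ^ (j + 1)) (tabsComp (j + 1) (one_le_of_neZero Lc) R.hr (P.cM (j + 1))).mixFF 0 κ u ρ (translate M' w n) x z a c)) μ y ν y' := by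
  obtain ⟨δG, CG, hδG, hCG, hG⟩ := decays_AN_family R j 0
  obtain ⟨CS, δS, hδS, hS⟩ := exists_locStencil_SN R P j 0
  obtain ⟨CM, δM, hδM, hMloc⟩ := (tabsComp (j + 1) (one_le_of_neZero Lc) R.hr (P.cM (j + 1))).hM 0
  obtain ⟨C₂, δ₂, hδ₂, hS₂⟩ := exists_locStencil₂_T2N R P j 0
  obtain ⟨Cm, δm, hδm, hM₂⟩ := exists_locStencilFM_M2N R P j (one_le_of_neZero Lc) 0
  have h := dper_tsum_W2SymOfK_translate M hM (shiftK_AN R j 0) hG hCG hδG (SN_translate R P j 0) hS hδS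
    ((tabsComp (j + 1) (one_le_of_neZero Lc) R.hr (P.cM (j + 1))).hMt 0) hMloc hδM (T2N_translate R P j 0) hS₂ hδ₂
    (M2Of_translate (Lc := Lc ^ (j + 1)) (tabsComp (j + 1) (one_le_of_neZero Lc) R.hr (P.cM (j + 1))).hmixt 0) hM₂ hδm μ y ν y'
  simpa only [WN_eq_W2SymOfK, AN_eq] using h

/-- [folklore] **`WN_wound_per_eq`** — the same as an equality of BOND FAMILIES:
`(μ y ν y′ ↦ dper M (x z ↦ Σ'_n WN R P j μ y ν (y′ + M′∘n) x z)) = W2SymOfK (AN R j) (Lc^(j+1)) S^per Mt^per T2^{per,csf} M2^{per,cs}` — the letter at which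
`CombHId2Folds` ∕ `CombHId2TorusWords`' torus readings of the four words apply to the wound N rows of (R1). -/
theorem WN_wound_per_eq (hM : ∀ i, M i = Lc ^ (j + 1) * M' i) :
    (fun μ y ν y' => dper M (fun x z a c => ∑' n : Site (3 + 1), WN R P j μ y ν (translate M' y' n) x z a c))
      = W2SymOfK (AN R j) (Lc ^ (j + 1))
          (fun κ u => dper M (SpureRecOf 3 (Lc ^ (j + 1)) (tabsComp (j + 1) (one_le_of_neZero Lc) R.hr (P.cM (j + 1))).V
            (tabsComp (j + 1) (one_le_of_neZero Lc) R.hr (P.cM (j + 1))).H (fun _ => compChart R.rc Lc (j + 1) (R.s (j + 1)) (Lc ^ (j + 1)))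
            (P.cE (j + 1)) (P.cVH (j + 1)) (P.cΛ (j + 1)) 0 κ u))
          (fun ρ w => dper M ((tabsComp (j + 1) (one_le_of_neZero Lc) R.hr (P.cM (j + 1))).M 0 ρ w))
          (fun κ u κ' u' => dper M (fun x z a c => ∑' n : Site (3 + 1),
            T2RecOf 3 (Lc ^ (j + 1)) (fun _ => compChart R.rc Lc (j + 1) (R.s (j + 1)) (Lc ^ (j + 1)))
              (SpureRecOf 3 (Lc ^ (j + 1)) (tabsComp (j + 1) (one_le_of_neZero Lc) R.hr (P.cM (j + 1))).V
                (tabsComp (j + 1) (one_le_of_neZero Lc) R.hr (P.cM (j + 1))).H (fun _ => compChart R.rc Lc (j + 1) (R.s (j + 1)) (Lc ^ (j + 1)))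
                (P.cE (j + 1)) (P.cVH (j + 1)) (P.cΛ (j + 1)))
              (tabsComp (j + 1) (one_le_of_neZero Lc) R.hr (P.cM (j + 1))).M (P.cE₂ (j + 1)) (P.cB (j + 1)) (P.T (j + 1))
              (tabsComp (j + 1) (one_le_of_neZero Lc) R.hr (P.cM (j + 1))).vh₂S (tabsComp (j + 1) (one_le_of_neZero Lc) R.hr (P.cM (j + 1))).mixFF 0
              κ u κ' (translate M u' n) x z a c))
          (fun κ u ρ w => dper M (fun x z a c => ∑' n : Site (3 + 1),
            M2Of 3 (Lc ^ (j + 1)) (tabsComp (j + 1) (one_le_of_neZero Lc) R.hr (P.cM (j + 1))).mixFF 0 κ u ρ (translate M' w n) x z a c)) := by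
  funext μ y ν y'
  exact dper_tsum_WN R P j M hM μ y ν y'

end WSlot

end Summit.QuantumFields.BalabanUV.Beta.NVertexWoundPeriodised

end
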